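import Summits.CriticalPhenomena.PercolationContinuityZ3.Theorems.PercNearOneGluingNoHeavyLowerTailThreeRelaySliding
import Summits.CriticalPhenomena.PercolationContinuityZ3.Theorems.PercNearOneGluingNoHeavyLowerTailRMaxReduction
import Summits.CriticalPhenomena.PercolationContinuityZ3.Theorems.PercNearOneGluingNoHeavyLowerTailChampionStability
import Summits.CriticalPhenomena.PercolationContinuityZ3.Theorems.PercNearOneGluingNoHeavyLowerTailCILScaledReferenceTools
import Summits.CriticalPhenomena.PercolationContinuityZ3.Theorems.PercNearOneGluingAdditiveGluingGoodStepOneBond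
import HarnessLib

/-!
# `NoHeavyLowerTail` (stmt-CriticalPhenomena-4575) — the PRE-GLUING exchange: the attached exchange of an observer holds as
# soon as `q` beats the relay AFTER the observer is glued onto it, hence (persistence) as soon as `q` beats the relay BEFORE
# the observer's block is glued together — GREX for `|Q| = 1`

Support file (lemma factory #8 `prim-lf-8`, gen 11; `--supports stmt-CriticalPhenomena-4575`).  No definitions, no named
facts, no sorries.  `μ_v = prodBernoulli v` on `Fin n`, relays `A`, level `j`, `π(z) = {a ∈ A : z ↔ a}`, `L_z = {|π(z)| ≤ j}`,
`H_z = {|π(z)| > j}`, `S_v(z) = μ_v(L_z)`.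

* `PreGluingExchange.attachedExchange_of_gluedBeating` — for distinct vertices `x, c, q` and ANY weights `v`: if
  `S_{v[s(x,c)↦1]}(x) ≤ S_{v[s(x,c)↦1]}(q)` (`q` beats `x` after the observer `c` is glued onto `x`) then
  `μ_v({c↔x} ∩ L_x ∩ H_q) ≤ μ_v({c↔x} ∩ H_x ∩ L_q)`.
  Proof: the BHK two-set exchange in the frame `({x,c}, {q})` (`setTwoClusterExchange`) bounds the attached odds by the
  odds of the BLOCK `{x,c}`, `μ_v(D ∩ L_{xc} ∩ H_q) / μ_v(D ∩ H_{xc} ∩ L_q)` (`D = {x↮q}∩{c↮q}`, `L_{xc} = {|π(x) ∪ π(c)| ≤ j}`),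
  and these two block masses are `μ_{v[s(x,c)↦1]}(L_x ∩ H_q)`, `μ_{v[s(x,c)↦1]}(H_x ∩ L_q)` (`glued_mass_eq`, pushforward
  `goodStep_real_update_one` along `ω ↦ ω ∪ {s(x,c)}` and reachability after opening one pair, `ChampionStability.reachable_insert_*`).
  The point: the hypothesis is NOT that `q` beats `x` in `v` (that is the conditioned championship exchange PEX) — after
  gluing a block onto the observer that may fail — but block beating, which PERSISTS.
* `PreGluingExchange.beats_glueStar` — persistence along a star: if `S_w(x) ≤ S_w(q)` then after gluing `x` onto `c` and `c`
  onto every vertex of a list `l` (`q ∉ l`, pairs raised to weight `1`), still `S(x) ≤ S(q)`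
  (`HullPort.lightness_le_of_raise_own_edge` = raising a pair at the loser, `HullPort.lightness_eq_of_weight_one`).
* `PreGluingExchange.grex_singleton` — **GREX-0 for `|Q| = 1`**: if `q` beats `x` in `w` then for the block observer obtained
  by gluing `c` onto the vertices of `l` (star of weight-1 pairs at `c`; `x, q ∉ l`), the attached exchange holds:
  `μ_{w̃}({c↔x} ∩ L_x ∩ H_q) ≤ μ_{w̃}({c↔x} ∩ H_x ∩ L_q)` — beating measured BEFORE gluing, exchange AFTER (prim-lf-8
  CANDIDATES v10 B10-2; the `|Q| ≥ 2` case is the root conjecture behind `CornerReduction.noHeavyLowerTail_of_grex`).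
-/

noncomputable section

namespace Summit.CriticalPhenomena.PercolationContinuityZ3.Theorems

open MeasureTheory Set Literature.Probability.LatticeModels Literature.Probability.Percolation
open scoped Classical BigOperators

variable {n : ℕ}

namespace PreGluingExchange

open ConditionedChampionExchange ConditionedChampionExchangeSets ThreeRelaySliding ChampionStability

/-! ### Reachability after opening the pair `s(x,c)` -/

/-- After opening `s(x,c)`: `x ↔' r` iff `x ↔ r` or `c ↔ r`. [folklore] -/
theorem filter_insert_eq_union (A : Finset (Fin n)) {x c : Fin n} (hxc : x ≠ c) (ω : BondConfig (Fin n)) :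
    (A.filter fun r => insert s(x, c) ω ∈ openConn x r) = A.filter fun r => ω ∈ openConn x r ∨ ω ∈ openConn c r := by
  apply Finset.filter_congr
  intro r _
  exact reachable_insert_left_iff ω hxc r

/-- After opening `s(x,c)`, a vertex `q` separated from `x` and `c` keeps its relay set. [folklore] -/
theorem filter_insert_eq_of_sep (A : Finset (Fin n)) {x c q : Fin n} (hxc : x ≠ c) {ω : BondConfig (Fin n)}
    (hqx : ¬ (openGraph ω).Reachable q x) (hqc : ¬ (openGraph ω).Reachable q c) :
    (A.filter fun r => insert s(x, c) ω ∈ openConn q r) = A.filter fun r => ω ∈ openConn q r := by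
  apply Finset.filter_congr
  intro r _
  exact reachable_insert_iff_of_not ω hxc hqx hqc r

/-- **Glued masses.**  For incompatible predicates `P, Pq` on relay counts (never both true of the same number):
`μ_{v[s(x,c)↦1]}({P |π(x)|} ∩ {Pq |π(q)|}) = μ_v({x↮q} ∩ {c↮q} ∩ {P |π(x) ∪ π(c)|} ∩ {Pq |π(q)|})`. [folklore] -/
theorem glued_mass_eq (v : Sym2 (Fin n) → unitInterval) (A : Finset (Fin n)) {x c q : Fin n} (hxc : x ≠ c)
    (P Pq : ℕ → Prop) (hP : ∀ m, ¬ (P m ∧ Pq m)) :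
    (prodBernoulli (Function.update v s(x, c) 1)).real
        ({ω : BondConfig (Fin n) | P (A.filter fun r => ω ∈ openConn x r).card} ∩
          {ω | Pq (A.filter fun r => ω ∈ openConn q r).card}) =
      (prodBernoulli v).real ((((openConn x q : Set (BondConfig (Fin n)))ᶜ ∩ (openConn c q : Set (BondConfig (Fin n)))ᶜ) ∩
        {ω | P (A.filter fun r => ω ∈ openConn x r ∨ ω ∈ openConn c r).card}) ∩
          {ω | Pq (A.filter fun r => ω ∈ openConn q r).card}) := by
  rw [goodStep_real_update_one v hxc]
  congr 1
  ext ω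
  simp only [mem_setOf_eq, mem_inter_iff, mem_compl_iff, union_singleton]
  constructor
  · rintro ⟨hPx, hPq⟩
    rw [filter_insert_eq_union A hxc] at hPx
    -- `q` is separated from `x` and `c`: otherwise `q ↔' x` and the two relay sets would coincide
    have hsep : ¬ (openGraph ω).Reachable q x ∧ ¬ (openGraph ω).Reachable q c := by
      by_contra hcon
      have hqx' : (openGraph (insert s(x, c) ω)).Reachable q x := by
        rw [reachable_insert_to_left_iff ω hxc q]
        tauto
      have heq := filter_eq_of_openConn A (x := q) (c := x) (ω := insert s(x, c) ω) hqx'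
      rw [filter_insert_eq_union A hxc] at heq
      rw [heq] at hPq
      exact hP _ ⟨hPx, hPq⟩
    rw [filter_insert_eq_of_sep A hxc hsep.1 hsep.2] at hPq
    refine ⟨⟨⟨fun h => hsep.1 ?_, fun h => hsep.2 ?_⟩, hPx⟩, hPq⟩
    · exact SimpleGraph.Reachable.symm h
    · exact SimpleGraph.Reachable.symm h
  · rintro ⟨⟨⟨hxq, hcq⟩, hPx⟩, hPq⟩
    have hqx : ¬ (openGraph ω).Reachable q x := fun h => hxq (SimpleGraph.Reachable.symm h)
    have hqc : ¬ (openGraph ω).Reachable q c := fun h => hcq (SimpleGraph.Reachable.symm h)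
    rw [filter_insert_eq_union A hxc, filter_insert_eq_of_sep A hxc hqx hqc]
    exact ⟨hPx, hPq⟩

/-- `{|π(x) ∪ π(c)| > j}` is of type `(+)` for `(C_{{x,c}}, C_T)`. [folklore] -/
theorem unionHeavy_typePlus (A : Finset (Fin n)) (x c : Fin n) (T : Set (Fin n)) (j : ℕ) ⦃ω ω' : BondConfig (Fin n)⦄
    (hs : (⋃ s ∈ ({x, c} : Set (Fin n)), openEdgeCluster ω s) ⊆ (⋃ s ∈ ({x, c} : Set (Fin n)), openEdgeCluster ω' s))
    (ht : (⋃ t ∈ T, openEdgeCluster ω' t) ⊆ (⋃ t ∈ T, openEdgeCluster ω t))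
    (h : ω ∈ {ω : BondConfig (Fin n) | j < (A.filter fun r => ω ∈ openConn x r ∨ ω ∈ openConn c r).card}) :
    ω' ∈ {ω : BondConfig (Fin n) | j < (A.filter fun r => ω ∈ openConn x r ∨ ω ∈ openConn c r).card} := by
  simp only [mem_setOf_eq] at h ⊢
  refine lt_of_lt_of_le h (Finset.card_le_card fun r hr => ?_)
  simp only [Finset.mem_filter] at hr ⊢
  refine ⟨hr.1, ?_⟩
  rcases hr.2 with h' | h'
  · exact Or.inl (TwoSetExchange.typePlus_openConn_of_mem ({x, c} : Set (Fin n)) T (mem_insert x {c}) r hs ht h')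
  · exact Or.inr (TwoSetExchange.typePlus_openConn_of_mem ({x, c} : Set (Fin n)) T
      (mem_insert_of_mem x (mem_singleton c)) r hs ht h')

/-! ### The attached exchange from glued beating -/

/-- **Attached exchange from glued beating.**  For distinct `x, c, q`: if `q` beats `x` after gluing the observer `c` onto `x`
(`S_{v[s(x,c)↦1]}(x) ≤ S_{v[s(x,c)↦1]}(q)`) then `μ_v({c↔x} ∩ L_x ∩ H_q) ≤ μ_v({c↔x} ∩ H_x ∩ L_q)`.
[cite: VandenbergHaggstromKahn2005, Thm. 2.1 (p. 9) at q = 1 — corollary, this work] -/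
theorem attachedExchange_of_gluedBeating (v : Sym2 (Fin n) → unitInterval) (A : Finset (Fin n)) (x c q : Fin n) (j : ℕ)
    (hxc : x ≠ c)
    (hbeat : (prodBernoulli (Function.update v s(x, c) 1)).real
          {ω : BondConfig (Fin n) | (A.filter fun r => ω ∈ openConn x r).card ≤ j} ≤
        (prodBernoulli (Function.update v s(x, c) 1)).real
          {ω : BondConfig (Fin n) | (A.filter fun r => ω ∈ openConn q r).card ≤ j}) :
    (prodBernoulli v).real (((openConn c x : Set (BondConfig (Fin n))) ∩
        {ω | (A.filter fun r => ω ∈ openConn x r).card ≤ j}) ∩ {ω | j < (A.filter fun r => ω ∈ openConn q r).card}) ≤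
      (prodBernoulli v).real (((openConn c x : Set (BondConfig (Fin n))) ∩
        {ω | j < (A.filter fun r => ω ∈ openConn x r).card}) ∩ {ω | (A.filter fun r => ω ∈ openConn q r).card ≤ j}) := by
  set μ := prodBernoulli v with hμ
  set K : Set (BondConfig (Fin n)) := (openConn c x : Set (BondConfig (Fin n))) with hK
  set D : Set (BondConfig (Fin n)) := (openConn x q : Set (BondConfig (Fin n)))ᶜ ∩ (openConn c q : Set (BondConfig (Fin n)))ᶜ
    with hD
  set Lx : Set (BondConfig (Fin n)) := {ω | (A.filter fun r => ω ∈ openConn x r).card ≤ j} with hLx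
  set Hx : Set (BondConfig (Fin n)) := {ω | j < (A.filter fun r => ω ∈ openConn x r).card} with hHx
  set Lq : Set (BondConfig (Fin n)) := {ω | (A.filter fun r => ω ∈ openConn q r).card ≤ j} with hLq
  set Hq : Set (BondConfig (Fin n)) := {ω | j < (A.filter fun r => ω ∈ openConn q r).card} with hHq
  set LS : Set (BondConfig (Fin n)) := {ω | (A.filter fun r => ω ∈ openConn x r ∨ ω ∈ openConn c r).card ≤ j} with hLS
  set HS : Set (BondConfig (Fin n)) := {ω | j < (A.filter fun r => ω ∈ openConn x r ∨ ω ∈ openConn c r).card} with hHS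
  have hmeas : ∀ s : Set (BondConfig (Fin n)), MeasurableSet s := fun _ => MeasurableSet.of_discrete
  have hnn : ∀ s : Set (BondConfig (Fin n)), 0 ≤ μ.real s := fun _ => measureReal_nonneg
  have mono : ∀ {s t : Set (BondConfig (Fin n))}, s ⊆ t → μ.real s ≤ μ.real t :=
    fun h => measureReal_mono h (measure_ne_top μ _)
  -- BHK in the frame `({x,c},{q})`
  have hc : c ∈ ({x, c} : Set (Fin n)) := mem_insert_of_mem x (mem_singleton c)
  have hq : q ∈ ({q} : Set (Fin n)) := mem_singleton q
  have key := setTwoClusterExchange v ({x, c} : Set (Fin n)) ({q} : Set (Fin n))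
    (A₁ := K) (A₂ := HS ∩ Lq) (B₁ := LS ∩ Hq) (B₂ := univ)
    (fun ω ω' hs ht h => TwoSetExchange.typePlus_openConn_of_mem _ _ hc x hs ht h)
    (fun ω ω' hs ht h => ⟨unionHeavy_typePlus A x c _ j hs ht h.1, light_typePlus_of_mem A _ _ hq j hs ht h.2⟩)
    (fun ω ω' hs ht h => ⟨unionLight_typeMinus A x c _ j hs ht h.1, heavy_typePlus_of_mem A _ _ hq j ht hs h.2⟩)
    (fun _ _ _ _ _ => mem_univ _)
  rw [sep_pair_eq x c q] at key
  simp only [inter_univ] at key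
  change μ.real (D ∩ (K ∩ (LS ∩ Hq))) * μ.real (D ∩ (HS ∩ Lq)) ≤ μ.real (D ∩ (K ∩ (HS ∩ Lq))) * μ.real (D ∩ (LS ∩ Hq))
    at key
  -- on `{c ↔ x}` the pair count is `x`'s count, and the lightness mismatch forces `D`
  have hfilt : ∀ ω : BondConfig (Fin n), ω ∈ K →
      (A.filter fun r => ω ∈ openConn x r ∨ ω ∈ openConn c r) = (A.filter fun r => ω ∈ openConn x r) := by
    intro ω hk
    have e := filter_eq_of_openConn A (x := c) (c := x) hk
    ext r
    simp only [Finset.mem_filter, and_congr_right_iff]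
    intro hr
    constructor
    · rintro (h | h)
      · exact h
      · have : r ∈ A.filter fun r => ω ∈ openConn c r := Finset.mem_filter.2 ⟨hr, h⟩
        rw [e] at this
        exact (Finset.mem_filter.1 this).2
    · exact fun h => Or.inl h
  have hDof : ∀ ω : BondConfig (Fin n), ω ∈ K → ¬ (openGraph ω).Reachable x q → ω ∈ D := by
    intro ω hk hxq
    refine ⟨hxq, fun hcq => hxq ?_⟩
    have hcx : (openGraph ω).Reachable c x := hk
    exact hcx.symm.trans hcq
  have e1 : D ∩ (K ∩ (LS ∩ Hq)) = K ∩ Lx ∩ Hq := by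
    ext ω
    constructor
    · rintro ⟨-, hk, hls, hh⟩
      refine ⟨⟨hk, ?_⟩, hh⟩
      simp only [hLS, hLx, mem_setOf_eq] at hls ⊢
      rwa [hfilt ω hk] at hls
    · rintro ⟨⟨hk, hl⟩, hh⟩
      have hxq : ¬ (openGraph ω).Reachable x q := fun h => light_heavy_subset_compl A x q j ⟨hl, hh⟩ h
      refine ⟨hDof ω hk hxq, hk, ?_, hh⟩
      simp only [hLS, hLx, mem_setOf_eq] at hl ⊢
      rwa [hfilt ω hk]
  have e2 : D ∩ (K ∩ (HS ∩ Lq)) = K ∩ Hx ∩ Lq := by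
    ext ω
    constructor
    · rintro ⟨-, hk, hhs, hl⟩
      refine ⟨⟨hk, ?_⟩, hl⟩
      simp only [hHS, hHx, mem_setOf_eq] at hhs ⊢
      rwa [hfilt ω hk] at hhs
    · rintro ⟨⟨hk, hh⟩, hl⟩
      have hxq : ¬ (openGraph ω).Reachable x q := by
        intro h
        have := light_heavy_subset_compl A q x j ⟨hl, hh⟩
        rw [KNPreFKG.openConn_symm q x] at this
        exact this h
      refine ⟨hDof ω hk hxq, hk, ?_, hl⟩
      simp only [hHS, hHx, mem_setOf_eq] at hh ⊢
      rwa [hfilt ω hk]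
  rw [e1, e2] at key
  -- the block masses are the glued masses
  have hP1 : ∀ m : ℕ, ¬ (m ≤ j ∧ j < m) := fun m h => absurd h.1 (not_le.2 h.2)
  have hP2 : ∀ m : ℕ, ¬ (j < m ∧ m ≤ j) := fun m h => absurd h.2 (not_le.2 h.1)
  have g1 : (prodBernoulli (Function.update v s(x, c) 1)).real (Lx ∩ Hq) = μ.real (D ∩ (LS ∩ Hq)) := by
    rw [hLx, hHq, glued_mass_eq v A hxc (fun m => m ≤ j) (fun m => j < m) hP1, hμ, hD, hLS]
    simp only [inter_assoc]
  have g2 : (prodBernoulli (Function.update v s(x, c) 1)).real (Hx ∩ Lq) = μ.real (D ∩ (HS ∩ Lq)) := by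
    rw [hHx, hLq, glued_mass_eq v A hxc (fun m => j < m) (fun m => m ≤ j) hP2, hμ, hD, hHS]
    simp only [inter_assoc]
  have hb : μ.real (D ∩ (LS ∩ Hq)) ≤ μ.real (D ∩ (HS ∩ Lq)) := by
    rw [← g1, ← g2]
    exact RMaxReduction.lightHeavy_le_of_beats (Function.update v s(x, c) 1) A x q j hbeat
  by_cases hpos : 0 < μ.real (D ∩ (HS ∩ Lq))
  · have h1 : μ.real (K ∩ Lx ∩ Hq) * μ.real (D ∩ (HS ∩ Lq)) ≤ μ.real (K ∩ Hx ∩ Lq) * μ.real (D ∩ (HS ∩ Lq)) :=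
      le_trans key (mul_le_mul_of_nonneg_left hb (hnn _))
    exact le_of_mul_le_mul_right h1 hpos
  · have h0 : μ.real (D ∩ (HS ∩ Lq)) = 0 := le_antisymm (not_lt.1 hpos) (hnn _)
    have h0' : μ.real (D ∩ (LS ∩ Hq)) = 0 := le_antisymm (h0 ▸ hb) (hnn _)
    have hsub : K ∩ Lx ∩ Hq ⊆ D ∩ (LS ∩ Hq) := by
      rw [← e1]; exact fun ω h => ⟨h.1, h.2.2⟩
    calc μ.real (K ∩ Lx ∩ Hq) ≤ μ.real (D ∩ (LS ∩ Hq)) := mono hsub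
      _ = 0 := h0'
      _ ≤ μ.real (K ∩ Hx ∩ Lq) := hnn _

/-! ### Persistence of beating along a star of glued pairs -/

/-- **Persistence along a star.**  If `q` beats `c` in `w` then it still beats `c` after the pairs `s(c,u)`, `u ∈ l`
(`u ≠ c`, `u ≠ q`), are raised to weight `1` one after the other (`HullPort.lightness_le_of_raise_own_edge`). [this work] -/
theorem beats_glueStar (A : Finset (Fin n)) (c q : Fin n) (j : ℕ) (hqc : q ≠ c) :
    ∀ (l : List (Fin n)) (w : Sym2 (Fin n) → unitInterval), (∀ u ∈ l, u ≠ c ∧ u ≠ q) →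
      (prodBernoulli w).real {ω : BondConfig (Fin n) | (A.filter fun r => ω ∈ openConn c r).card ≤ j} ≤
        (prodBernoulli w).real {ω : BondConfig (Fin n) | (A.filter fun r => ω ∈ openConn q r).card ≤ j} →
      (prodBernoulli (l.foldr (fun u w' => Function.update w' s(c, u) 1) w)).real
          {ω : BondConfig (Fin n) | (A.filter fun r => ω ∈ openConn c r).card ≤ j} ≤
        (prodBernoulli (l.foldr (fun u w' => Function.update w' s(c, u) 1) w)).real
          {ω : BondConfig (Fin n) | (A.filter fun r => ω ∈ openConn q r).card ≤ j} := by
  intro l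
  induction l with
  | nil => intro w _ h; simpa using h
  | cons u l ih =>
    intro w hl h
    have hu := hl u (by simp)
    have hl' : ∀ u' ∈ l, u' ≠ c ∧ u' ≠ q := fun u' hu' => hl u' (by simp [hu'])
    have step := ih w hl' h
    set w' := l.foldr (fun u w' => Function.update w' s(c, u) 1) w with hw'
    show (prodBernoulli (Function.update w' s(c, u) 1)).real _ ≤ (prodBernoulli (Function.update w' s(c, u) 1)).real _
    have h0 : Function.update w' s(c, u) (w' s(c, u)) = w' := Function.update_eq_self _ _
    have key := HullPort.lightness_le_of_raise_own_edge w' A c u q j hu.1.symm hqc (w' s(c, u)) 1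
      (unitInterval.le_one _) (by rw [h0]; exact step)
    exact key

/-- **GREX-0 for `|Q| = 1` (pre-gluing exchange).**  Let `x, c, q` be distinct and `l` a list of vertices avoiding `x, c, q`;
let `w̃` be `w` with the pairs `s(c,u)`, `u ∈ l`, raised to weight `1` (the observer `c` glued onto its block).  If `q` beats
`x` in `w` (BEFORE gluing) then `μ_{w̃}({c↔x} ∩ L_x ∩ H_q) ≤ μ_{w̃}({c↔x} ∩ H_x ∩ L_q)` — although `q` need not beat `x`
in `w̃`.  Proof: `attachedExchange_of_gluedBeating` in `w̃`; its hypothesis (beating after gluing `c` onto `x` as well) follows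
from beating in `w` by raising `s(x,c)` at the loser `x`, transferring to `c` (`lightness_eq_of_weight_one`) and
`beats_glueStar`. [this work] -/
theorem grex_singleton (w : Sym2 (Fin n) → unitInterval) (A : Finset (Fin n)) (x c q : Fin n) (j : ℕ) (l : List (Fin n))
    (hxc : x ≠ c) (hqx : q ≠ x) (hqc : q ≠ c) (hl : ∀ u ∈ l, u ≠ c ∧ u ≠ q ∧ u ≠ x)
    (hbeat : (prodBernoulli w).real {ω : BondConfig (Fin n) | (A.filter fun r => ω ∈ openConn x r).card ≤ j} ≤
      (prodBernoulli w).real {ω : BondConfig (Fin n) | (A.filter fun r => ω ∈ openConn q r).card ≤ j}) :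
    (prodBernoulli (l.foldr (fun u w' => Function.update w' s(c, u) 1) w)).real
        (((openConn c x : Set (BondConfig (Fin n))) ∩ {ω | (A.filter fun r => ω ∈ openConn x r).card ≤ j}) ∩
          {ω | j < (A.filter fun r => ω ∈ openConn q r).card}) ≤
      (prodBernoulli (l.foldr (fun u w' => Function.update w' s(c, u) 1) w)).real
        (((openConn c x : Set (BondConfig (Fin n))) ∩ {ω | j < (A.filter fun r => ω ∈ openConn x r).card}) ∩
          {ω | (A.filter fun r => ω ∈ openConn q r).card ≤ j}) := by
  set glue : (Sym2 (Fin n) → unitInterval) → (Sym2 (Fin n) → unitInterval) :=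
    fun v => l.foldr (fun u w' => Function.update w' s(c, u) 1) v with hglue
  -- gluing commutes with raising `s(x,c)` (all pairs distinct)
  have hcomm : ∀ (l' : List (Fin n)), (∀ u ∈ l', u ≠ x) → ∀ v : Sym2 (Fin n) → unitInterval,
      l'.foldr (fun u w' => Function.update w' s(c, u) 1) (Function.update v s(x, c) 1) =
        Function.update (l'.foldr (fun u w' => Function.update w' s(c, u) 1) v) s(x, c) 1 := by
    intro l'
    induction l' with
    | nil => intro _ v; simp
    | cons u l' ih =>
      intro hl' v
      have hu : u ≠ x := hl' u (by simp)
      have ih' := ih (fun u' hu' => hl' u' (by simp [hu'])) v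
      simp only [List.foldr_cons]
      rw [ih']
      have hne : s(c, u) ≠ s(x, c) := by
        intro h
        rcases Sym2.eq_iff.1 h with ⟨h1, -⟩ | ⟨-, h2⟩
        · exact hxc h1.symm
        · exact hu h2
      exact Function.update_comm hne.symm _ _ _
  -- the weights with `x` glued onto `c` as well
  have hw1 : (prodBernoulli (Function.update w s(x, c) 1)).real
        {ω : BondConfig (Fin n) | (A.filter fun r => ω ∈ openConn x r).card ≤ j} ≤
      (prodBernoulli (Function.update w s(x, c) 1)).real
        {ω : BondConfig (Fin n) | (A.filter fun r => ω ∈ openConn q r).card ≤ j} := by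
    have h0 : Function.update w s(x, c) (w s(x, c)) = w := Function.update_eq_self _ _
    exact HullPort.lightness_le_of_raise_own_edge w A x c q j hxc hqx (w s(x, c)) 1 (unitInterval.le_one _)
      (by rw [h0]; exact hbeat)
  have hxc1 : ∀ v : Sym2 (Fin n) → unitInterval, Function.update v s(x, c) 1 s(c, x) = 1 := by
    intro v; rw [Sym2.eq_swap]; exact Function.update_self _ _ _
  -- transfer to `c`, glue the star at `c`, transfer back to `x`
  have hc1 : (prodBernoulli (Function.update w s(x, c) 1)).real
        {ω : BondConfig (Fin n) | (A.filter fun r => ω ∈ openConn c r).card ≤ j} ≤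
      (prodBernoulli (Function.update w s(x, c) 1)).real
        {ω : BondConfig (Fin n) | (A.filter fun r => ω ∈ openConn q r).card ≤ j} := by
    rw [HullPort.lightness_eq_of_weight_one _ A hxc.symm j (hxc1 w)]; exact hw1
  have hl' : ∀ u ∈ l, u ≠ c ∧ u ≠ q := fun u hu => ⟨(hl u hu).1, (hl u hu).2.1⟩
  have hstar := beats_glueStar A c q j hqc l (Function.update w s(x, c) 1) hl' hc1
  rw [hcomm l (fun u hu => (hl u hu).2.2) w] at hstar
  have hglued : (prodBernoulli (Function.update (glue w) s(x, c) 1)).real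
        {ω : BondConfig (Fin n) | (A.filter fun r => ω ∈ openConn x r).card ≤ j} ≤
      (prodBernoulli (Function.update (glue w) s(x, c) 1)).real
        {ω : BondConfig (Fin n) | (A.filter fun r => ω ∈ openConn q r).card ≤ j} := by
    rw [← HullPort.lightness_eq_of_weight_one _ A hxc.symm j (hxc1 (glue w))]; exact hstar
  exact attachedExchange_of_gluedBeating (glue w) A x c q j hxc hglued

end PreGluingExchange

end Summit.CriticalPhenomena.PercolationContinuityZ3.Theorems

end
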